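import Literature.NumberTheory.LFunctions.KloostermanFractionsAmplifier
import HarnessLib

/-!
# Bilinear forms with Kloosterman fractions: the amplifying primes

For the amplification step of Duke–Friedlander–Iwaniec / Bettin–Chandee (§3: "we introduce an
amplifier over the primes `ℓ ∈ [L, 2L]` coprime to `bϑ`"), we take
`𝓛 = {L < ℓ ≤ 2L prime : (ℓ, b) = (ℓ, k) = 1}` and record: every `ℓ ∈ 𝓛` is a prime in `(L,2L]`
coprime to `b` and `k`; `#𝓛 ≤ L`; and for every `m ≥ 1`,
`#{ℓ ∈ 𝓛 : (ℓ, m) = 1} ≥ L/(2 log L) - (log b + log |k| + log m)/log L` (prime number theorem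
in the form `DFI_card_primes_Ioc_ge`, and `ω_𝓛(n) log L ≤ log n`).

## References
* S. Bettin, V. Chandee, Adv. Math. 328 (2018), arXiv:1502.00769, §3. [cite: BettinChandee2018, §3]
* W. Duke, J. Friedlander, H. Iwaniec, Invent. Math. 128 (1997) 23–43, §3.
  [cite: DukeFriedlanderIwaniec1997, §3]
-/

noncomputable section

open Finset

namespace Literature.NumberTheory.LFunctions

/-- **The amplifying primes** `𝓛 = {L < ℓ ≤ 2L prime, (ℓ, bk) = 1}`: membership properties and
`#𝓛 ≤ L`. [cite: BettinChandee2018, §3] -/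
theorem kfp_primes_mem {L : ℕ} (b : ℕ) (k : ℤ) :
    (∀ ℓ ∈ (Ioc L (2 * L)).filter (fun ℓ => ℓ.Prime ∧ ℓ.Coprime b ∧ ℓ.Coprime k.natAbs),
      ℓ.Prime ∧ L < ℓ ∧ ℓ ≤ 2 * L ∧ ℓ.Coprime b ∧ Int.gcd k ℓ = 1) ∧
    ((Ioc L (2 * L)).filter (fun ℓ => ℓ.Prime ∧ ℓ.Coprime b ∧ ℓ.Coprime k.natAbs)).card ≤ L := by
  constructor
  · intro ℓ hℓ
    obtain ⟨h1, hp, hb, hk⟩ := Finset.mem_filter.mp hℓ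
    refine ⟨hp, (Finset.mem_Ioc.mp h1).1, (Finset.mem_Ioc.mp h1).2, hb, ?_⟩
    rw [Int.gcd_eq_natAbs, Int.natAbs_natCast]
    exact Nat.Coprime.symm hk
  · calc _ ≤ (Ioc L (2 * L)).card := Finset.card_filter_le _ _
      _ = L := by rw [Nat.card_Ioc]; omega

/-- **Enough amplifying primes coprime to `m`**: with `𝓛` as above, `L ≥ L₀` (the threshold of
`DFI_card_primes_Ioc_ge`), `L ≥ 2`, `b, m ≥ 1`, `k ≠ 0`,
`#{ℓ ∈ 𝓛 : (ℓ,m)=1} ≥ L/(2 log L) - (log b + log|k| + log m)/log L`.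
[cite: BettinChandee2018, §3] -/
theorem kfp_primes_coprime_card {L₀ : ℕ}
    (hL₀ : ∀ L : ℕ, L₀ ≤ L →
      (L : ℝ) / (2 * Real.log L) ≤ (((Finset.Ioc L (2 * L)).filter Nat.Prime).card : ℝ))
    {L : ℕ} (hL : L₀ ≤ L) (hL2 : 2 ≤ L) {b : ℕ} (hb : 0 < b) {k : ℤ} (hk : k ≠ 0) {m : ℕ}
    (hm : 0 < m) :
    (L : ℝ) / (2 * Real.log L) - (Real.log b + Real.log k.natAbs + Real.log m) / Real.log L ≤
      ((((Ioc L (2 * L)).filter (fun ℓ => ℓ.Prime ∧ ℓ.Coprime b ∧ ℓ.Coprime k.natAbs)).filter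
        (fun ℓ => ℓ.Coprime m)).card : ℝ) := by
  set 𝓟 := (Ioc L (2 * L)).filter Nat.Prime with h𝓟
  set 𝓛 := (Ioc L (2 * L)).filter (fun ℓ => ℓ.Prime ∧ ℓ.Coprime b ∧ ℓ.Coprime k.natAbs) with h𝓛
  have hLR : (1 : ℝ) ≤ L := by exact_mod_cast (by omega : 1 ≤ L)
  have hlogL : 0 < Real.log L := Real.log_pos (by exact_mod_cast (by omega : 1 < L))
  have h𝓟mem : ∀ ℓ ∈ 𝓟, ℓ.Prime ∧ (L : ℝ) < ℓ := by
    intro ℓ hℓ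
    obtain ⟨h1, hp⟩ := Finset.mem_filter.mp hℓ
    exact ⟨hp, by exact_mod_cast (Finset.mem_Ioc.mp h1).1⟩
  have h𝓛mem : ∀ ℓ ∈ 𝓛, ℓ.Prime ∧ (L : ℝ) < ℓ := by
    intro ℓ hℓ
    obtain ⟨h1, hp, _⟩ := Finset.mem_filter.mp hℓ
    exact ⟨hp, by exact_mod_cast (Finset.mem_Ioc.mp h1).1⟩
  have hk0 : 0 < k.natAbs := Int.natAbs_pos.mpr hk
  -- `#𝓟 ≤ #𝓛 + #{ℓ ∈ 𝓟 : ℓ ∣ b} + #{ℓ ∈ 𝓟 : ℓ ∣ |k|}`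
  have hcover : 𝓟 ⊆ 𝓛 ∪ (𝓟.filter (fun ℓ => ℓ ∣ b) ∪ 𝓟.filter (fun ℓ => ℓ ∣ k.natAbs)) := by
    intro ℓ hℓ
    obtain ⟨h1, hp⟩ := Finset.mem_filter.mp hℓ
    rw [Finset.mem_union, Finset.mem_union]
    by_cases hb' : ℓ.Coprime b
    · by_cases hk' : ℓ.Coprime k.natAbs
      · exact Or.inl (Finset.mem_filter.mpr ⟨h1, hp, hb', hk'⟩)
      · refine Or.inr (Or.inr (Finset.mem_filter.mpr ⟨hℓ, ?_⟩))
        by_contra hd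
        exact hk' ((hp.coprime_iff_not_dvd).mpr hd)
    · refine Or.inr (Or.inl (Finset.mem_filter.mpr ⟨hℓ, ?_⟩))
      by_contra hd
      exact hb' ((hp.coprime_iff_not_dvd).mpr hd)
  have hcard : (𝓟.card : ℝ) ≤ 𝓛.card + (𝓟.filter (fun ℓ => ℓ ∣ b)).card +
      (𝓟.filter (fun ℓ => ℓ ∣ k.natAbs)).card := by
    have h1 := Finset.card_le_card hcover
    have h2 := Finset.card_union_le 𝓛 (𝓟.filter (fun ℓ => ℓ ∣ b) ∪ 𝓟.filter (fun ℓ => ℓ ∣ k.natAbs))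
    have h3 := Finset.card_union_le (𝓟.filter (fun ℓ => ℓ ∣ b)) (𝓟.filter (fun ℓ => ℓ ∣ k.natAbs))
    have : 𝓟.card ≤ 𝓛.card + (𝓟.filter (fun ℓ => ℓ ∣ b)).card +
        (𝓟.filter (fun ℓ => ℓ ∣ k.natAbs)).card := by omega
    exact_mod_cast this
  have hdb := DFI_card_primes_dvd_mul_log_le hLR h𝓟mem hb
  have hdk := DFI_card_primes_dvd_mul_log_le hLR h𝓟mem hk0
  have hdm := DFI_card_primes_dvd_mul_log_le hLR h𝓛mem hm
  have hP := hL₀ L hL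
  have hcop := DFI_card_filter_coprime_eq (fun ℓ hℓ => (h𝓛mem ℓ hℓ).1) m
  have hsub : (𝓛.filter (fun ℓ => ℓ ∣ m)).card ≤ 𝓛.card := Finset.card_filter_le _ _
  have hcopR : (((𝓛.filter (fun ℓ => ℓ.Coprime m)).card : ℕ) : ℝ) =
      (𝓛.card : ℝ) - ((𝓛.filter (fun ℓ => ℓ ∣ m)).card : ℝ) := by
    rw [hcop, Nat.cast_sub hsub]
  rw [hcopR]
  -- divide the `log`-inequalities by `log L`
  have e1 : ((𝓟.filter (fun ℓ => ℓ ∣ b)).card : ℝ) ≤ Real.log b / Real.log L := by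
    rw [le_div_iff₀ hlogL]; exact hdb
  have e2 : ((𝓟.filter (fun ℓ => ℓ ∣ k.natAbs)).card : ℝ) ≤ Real.log k.natAbs / Real.log L := by
    rw [le_div_iff₀ hlogL]; exact hdk
  have e3 : ((𝓛.filter (fun ℓ => ℓ ∣ m)).card : ℝ) ≤ Real.log m / Real.log L := by
    rw [le_div_iff₀ hlogL]; exact hdm
  have e4 : (Real.log b + Real.log k.natAbs + Real.log m) / Real.log L =
      Real.log b / Real.log L + Real.log k.natAbs / Real.log L + Real.log m / Real.log L := by
    rw [add_div, add_div]
  rw [e4]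
  linarith

end Literature.NumberTheory.LFunctions

end
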